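/-
Copyright (c) 2026 the pub-hodgecm-mathlib formalisation cell (harness21).  Prover seat hodgecm-mathlib-R90-C133-p03 (g2) (released by the S5 dealer to S4 BY NAME, 22:54:46Z;
deal S4-R17 K2E2-plan (g6) 2026-09-04T23:05:51Z, DESK countersign F0P2-plan (g18) 23:02:17Z, LEAD #33 (B)), Track B ∕ K2-LIT, h413 = `stmt-HodgeConjecture-24833`, R90-TF section S4:
the (R-a) U-TWIN of ★ FILE 1c's kit law (ℓ8) — `OneDimHLawU` asks the singleton packet only for UNITARIZABLE one-dimensional classes — with the pinned packets
`packetHOfOneDimU` ∕ `packetHOfCharU (hu)`, the global twins `charPacketU` ∕ `rhoXiU`, and `hu` discharged at Rogawski's `ξ_v` by ★ (U-2ξ).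
-/
import Summits.HodgeConjecture.HodgeConjecture.Theorems.F0P3SpectralPacketXi      -- ★ `rhoXi` (e3) over `h8 : ∀ v, OneDimHLaw`; brings ★ FILE 3c `charPacket`∕`IsCharPacket`, ★ FILE 1c `OneDimHLaw`∕`packetHOfOneDim`∕`packetHOfChar`∕`trPktH_packetHOfChar`, ★ `isOpen_ker_xiLocalChar`
import Summits.HodgeConjecture.HodgeConjecture.Theorems.R90S5OfCharUnitarizable   -- ★ p862777 (this seat): (U-2) `isUnitarizable_mk_ofChar_of_norm_eq_one`, (U-2ξ) `isUnitarizable_mk_ofChar_xiLocalChar`, ★ (U-1) by import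
import HarnessLib

/-!
# R90-TF · S4 — `R90S4OneDimHLawU`: the (R-a) U-TWIN `OneDimHLawU` of the kit law (ℓ8) «one-dimensional representations of `H_v` are L-packets of cardinality one»,
# restricted to UNITARIZABLE classes, with its pinned packets and the global twins `charPacketU` ∕ `rhoXiU` (additive beside ★ FILE 1c and ★ `F0P3SpectralPacketXi`)

Cell `hodgecm-mathlib`, crux H413 = `stmt-HodgeConjecture-24833`, route of record `HCCMUnconditional`; R90-TF section S4 (dealer∕pen K2E2-plan (g6), ruling S4-R17 2026-09-04T23:05:51Z;
DESK F0P2-plan (g18) countersign 23:02:17Z (1)–(4); LEAD #33 (B)); hand R90-C133-p03 (g2).  Lane `--supports stmt-HodgeConjecture-24833 --as helper` (definition lane: this file adds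
`def`s); no instance, no notation, no `sorry`; ★ FILE 1c `F0P3LocalPacketKitOneDim` (1583c3160d368848) and ★ `F0P3SpectralPacketXi` are FROZEN — every declaration here is an
ADDITIVE twin in the same namespaces (dot-notation parity `𝔩.OneDimHLawU`, `𝔩.packetHOfOneDimU`, `𝔩.packetHOfCharU`).

WHY (S5-audit1 = K2E1-audit1 (g2), A2 FINDING 22:29:06Z, probe `A2_h8_OneDimHLaw_vacuity_probe` 210ea5d352c10160, (V1)–(V3′) kernel-checked): the family binder
`h8 : ∀ v, (𝔩 v).OneDimHLaw` is UNSATISFIABLE at the kit of record `𝔩 v := R90.S4.rogawskiLocalKit …` — at a place `v` of `L⁺` split in `L`, `U(Φ₁)_v ≃ L⁺_vˣ` is non-compact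
and `Ξ := 𝟙 ⊠ ‖·‖_v` is a smooth NON-unitary character, while the record kit's `memH` carriers contain a unitarizable member (S4-A `rogawskiLocalKit_isCarrierH_memH`), so (ℓ8) at
`r = ℂ_Ξ` fails ((V3′) `not_forall_oneDimHLaw_record_of_char`).  Every consumer, however, applies (ℓ8) ONLY at `r = ℂ_{ξ_v}` for a one-dimensional AUTOMORPHIC `ξ` of `H`
(★ `OneDimAutRepH`), and `ξ_v` is unitary (★ `OneDimAutRepH.norm_xiLocalChar_apply_eq_one` ⇐ ★ `unit_η`∕`unit_ψ`).  REPAIR (R-a), print-faithful [Rogawski1990 §12.1 type (3) lists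
the one-dimensional UNITARY `ξ_v` among the L-packets of cardinality one; §13.1 p. 199]: ask the law only for unitarizable classes.
* §1 **`OneDimHLawU`** (S5-audit1's wording, token for token): `∀ r, finrank r.V = 1 → (IrrClass.mk r).IsUnitarizable → ∃ ρ, 𝔩.memH ρ = {⟦r⟧} ∧ ∀ ρ', ⟦r⟧ ∈ 𝔩.memH ρ' → ρ' = ρ`;
  the monotone **`OneDimHLaw.toU`** (Old → New: nothing typed against (ℓ8) is wasted); `OneDimHLawU.existsUnique`; (V2) `not_isUnitarizable_mk_ofChar_of_norm_ne_one` (generic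
  contrapositive of ★ (U-1), the representation-theoretic half of the audit's witness — the record-kit halves (V1)(V3)(V3′) speak `rogawskiLocalKit` and live Lines-side).
* §2 **`packetHOfOneDimU (h) (r) (hr) (hu)`** + `memH_…`, `eq_…_of_mem`, and the COMPATIBILITY `packetHOfOneDimU (h.toU) … = packetHOfOneDim h …` (both are THE packet containing `⟦r⟧`).
* §3 **`packetHOfCharU (h) (χ) (hχ) (hu)`** + `memH_…`, `eq_…_of_mem`, `trPktH_…`, compatibility with ★ `packetHOfChar`; `packetHOfCharU_of_norm_eq_one` (`hu` from `‖χ‖ = 1` by ★ (U-2)).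
* §4 (ns `…F0P3GlobalPacket.GlobalPacketH`) **`charPacketU (h8U) (χ) (hχ) (hu)`** (+ `isCharPacket_charPacketU`, `IsCharPacket.eq_charPacketU`) and **`rhoXiU (h8U) (ξ)`** with
  `hu := R90.S5.isUnitarizable_mk_ofChar_xiLocalChar L ξ v` discharged INSIDE (+ `rhoXiU_isCharPacket`, `eq_rhoXiU_of_isCharPacket`, `rhoXiU_loc`, `memH_rhoXiU_loc`, and the
  compatibility `rhoXiU_toU_eq_rhoXi : rhoXiU (fun v => (h8 v).toU) ξ = rhoXi h8 ξ`).
CONSUMERS (S5's cascade, by name): C2 ED. 2 (`spectralPacketHOfOneDim` over `h8U`), F ED. 2, D ED. 4′; K2E1-typ1 (g2) HEADS-C2.ed2 `hu` token = ★ (U-2ξ).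
HONEST LABEL: HC_CM is proved only modulo the 7 printed citations (2 remaining named inputs: hLiu418 = `stmt-HodgeConjecture-24832`, h413 = `stmt-HodgeConjecture-24833`) until
rung 0 closes; REL ≠ ★ ≠ BUILT; binder-currency repair — this file pays no socket by itself; count-neutral.

## References
* [Rogawski1990] J. D. Rogawski, *Automorphic Representations of Unitary Groups in Three Variables*, Ann. of Math. Stud. 123 (1990), §12.1 p. 171 (L-packets on `H`, type (3)),
  §12.2 p. 174, §13.1 p. 199 («if `ξ ∈ Π(H)` is one-dimensional»), Prop. 13.1.4.
* [BushnellHenniart2006] C. J. Bushnell, G. Henniart, *The Local Langlands Conjecture for GL(2)* (2006), §1.5, §11.1.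
-/

set_option autoImplicit false
-- the mandated namespace repeats `HodgeConjecture.HodgeConjecture`, as in every `Theorems/*.lean` of this sub-problem
set_option linter.dupNamespace false

noncomputable section

open NumberField IsDedekindDomain MeasureTheory

namespace Summit.HodgeConjecture.HodgeConjecture.Cruxes.H413.F0P3LocalPacketKit

open Literature.NumberTheory Literature.NumberTheory.Automorphic Literature.NumberTheory.Automorphic.UnitaryGroup
open Literature.NumberTheory.Rogawski1990 Literature.NumberTheory.GaloisRepresentations

variable {L : Type} [Field L] [NumberField L] [IsCMField L] {H' : Matrix (Fin 3) (Fin 3) L}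
  {v : HeightOneSpectrum (𝓞 ↥(maximalRealSubfield L))}

namespace LocalPacketKit

/-! ## §1 (ℓ8ᵁ) The U-twin of the law: only UNITARIZABLE one-dimensional classes are asked to be singleton packets [§12.1 type (3); §13.1 p. 199] -/

/-- **(ℓ8ᵁ) «UNITARIZABLE ONE-DIMENSIONAL REPRESENTATIONS OF `H_v` ARE L-PACKETS OF CARDINALITY ONE»** — the (R-a) U-twin of ★ `OneDimHLaw` (S5-audit1's wording, token
for token): for every one-dimensional smooth irreducible `r` of `H_v` whose class is UNITARIZABLE (★ `IrrClass.IsUnitarizable`) there is a packet `ρ ∈ Π(H_v)` with `memH ρ = {⟦r⟧}`,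
and it is the only packet containing `⟦r⟧`.  Expected satisfiable at the kit of record — the (ℓ8) witness (a non-unitary `ℂ_Ξ` at a split place) is outside its scope by (V2)
below; the record-kit discharge itself is Lines-side ((V1)∕(V3′), S4-R17), not claimed here — and print lists exactly the unitary one-dimensional `ξ_v` among the L-packets of
cardinality one. [cite: Rogawski1990, §12.1 p. 171; §13.1 p. 199]
— a route-posited kit LAW of the engine line (a predicate on the posited datum `𝔩`, like ★ `OneDimHLaw`; hence untagged, not a Literature fact). -/
def OneDimHLawU (𝔩 : LocalPacketKit L H' v) : Prop :=
  ∀ r : SmoothIrrep ((UnitaryGroup.cmDatum L 2 (Matrix.of fun i j : Fin 2 => if i.val + j.val + 1 = 2 then (1 : L) else 0)).Local v ×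
      (UnitaryGroup.cmDatum L 1 (Matrix.of fun i j : Fin 1 => if i.val + j.val + 1 = 1 then (1 : L) else 0)).Local v),
    Module.finrank ℂ r.V = 1 → (IrrClass.mk r).IsUnitarizable →
      ∃ ρ : 𝔩.PktH, 𝔩.memH ρ = {IrrClass.mk r} ∧ ∀ ρ' : 𝔩.PktH, IrrClass.mk r ∈ 𝔩.memH ρ' → ρ' = ρ

/-- **MONOTONICITY (ℓ8) ⟹ (ℓ8ᵁ)** (Old → New): every kit satisfying ★ `OneDimHLaw` satisfies `OneDimHLawU` — so nothing typed against (ℓ8) is wasted. [cite: Rogawski1990, §12.1 p. 171] -/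
theorem OneDimHLaw.toU {𝔩 : LocalPacketKit L H' v} (h : 𝔩.OneDimHLaw) : 𝔩.OneDimHLawU :=
  fun r hr _ => h r hr

/-- Under (ℓ8ᵁ), the packet of a unitarizable one-dimensional class EXISTS UNIQUELY (`∃!`). [cite: Rogawski1990, §12.1; §13.1 p. 199] -/
theorem OneDimHLawU.existsUnique {𝔩 : LocalPacketKit L H' v} (h : 𝔩.OneDimHLawU)
    (r : SmoothIrrep ((UnitaryGroup.cmDatum L 2 (Matrix.of fun i j : Fin 2 => if i.val + j.val + 1 = 2 then (1 : L) else 0)).Local v ×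
      (UnitaryGroup.cmDatum L 1 (Matrix.of fun i j : Fin 1 => if i.val + j.val + 1 = 1 then (1 : L) else 0)).Local v))
    (hr : Module.finrank ℂ r.V = 1) (hu : (IrrClass.mk r).IsUnitarizable) :
    ∃! ρ : 𝔩.PktH, IrrClass.mk r ∈ 𝔩.memH ρ := by
  obtain ⟨ρ, hρ, huniq⟩ := h r hr hu
  exact ⟨ρ, by simp only [hρ, Finset.mem_singleton], huniq⟩

/-- **(V2) A NON-unitary character has a NON-unitarizable class** (the representation-theoretic half of the audit's split-place witness; contrapositive of ★ (U-1)
`norm_eq_one_of_isUnitarizable_ofChar`): such an `r = ℂ_Ξ` is outside the scope of (ℓ8ᵁ), which is why the U-twin is satisfiable where (ℓ8) is not.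
[cite: BushnellHenniart2006, §11.1] [cite: Rogawski1990, §12.1 p. 171] -/
theorem not_isUnitarizable_mk_ofChar_of_norm_ne_one {G : Type} [Group G] [TopologicalSpace G] [IsTopologicalGroup G] (Ξ : G →* ℂˣ)
    (hΞ : IsOpen ((Ξ.ker : Subgroup G) : Set G)) {g : G} (hg : ‖((Ξ g : ℂˣ) : ℂ)‖ ≠ 1) : ¬ (IrrClass.mk (SmoothIrrep.ofChar Ξ hΞ)).IsUnitarizable :=
  fun h => hg (R90.S5.norm_eq_one_of_isUnitarizable_ofChar Ξ hΞ h g)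

/-! ## §2 The pinned packet of a unitarizable one-dimensional class -/

/-- **THE packet `{⟦r⟧}` of a unitarizable one-dimensional `r`** under (ℓ8ᵁ) (a choice of a UNIQUELY determined packet — pinned).  U-twin of ★ `packetHOfOneDim`.
[cite: Rogawski1990, §12.1; §13.1 p. 199] -/
def packetHOfOneDimU (𝔩 : LocalPacketKit L H' v) (h : 𝔩.OneDimHLawU)
    (r : SmoothIrrep ((UnitaryGroup.cmDatum L 2 (Matrix.of fun i j : Fin 2 => if i.val + j.val + 1 = 2 then (1 : L) else 0)).Local v ×
      (UnitaryGroup.cmDatum L 1 (Matrix.of fun i j : Fin 1 => if i.val + j.val + 1 = 1 then (1 : L) else 0)).Local v))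
    (hr : Module.finrank ℂ r.V = 1) (hu : (IrrClass.mk r).IsUnitarizable) : 𝔩.PktH :=
  (h r hr hu).choose

/-- Its member set is `{⟦r⟧}`. [cite: Rogawski1990, §12.1] -/
theorem memH_packetHOfOneDimU (𝔩 : LocalPacketKit L H' v) (h : 𝔩.OneDimHLawU)
    (r : SmoothIrrep ((UnitaryGroup.cmDatum L 2 (Matrix.of fun i j : Fin 2 => if i.val + j.val + 1 = 2 then (1 : L) else 0)).Local v ×
      (UnitaryGroup.cmDatum L 1 (Matrix.of fun i j : Fin 1 => if i.val + j.val + 1 = 1 then (1 : L) else 0)).Local v))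
    (hr : Module.finrank ℂ r.V = 1) (hu : (IrrClass.mk r).IsUnitarizable) : 𝔩.memH (𝔩.packetHOfOneDimU h r hr hu) = {IrrClass.mk r} :=
  (h r hr hu).choose_spec.1

/-- It is the only packet containing `⟦r⟧` (the pin). [cite: Rogawski1990, §12.1] -/
theorem eq_packetHOfOneDimU_of_mem (𝔩 : LocalPacketKit L H' v) (h : 𝔩.OneDimHLawU)
    (r : SmoothIrrep ((UnitaryGroup.cmDatum L 2 (Matrix.of fun i j : Fin 2 => if i.val + j.val + 1 = 2 then (1 : L) else 0)).Local v ×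
      (UnitaryGroup.cmDatum L 1 (Matrix.of fun i j : Fin 1 => if i.val + j.val + 1 = 1 then (1 : L) else 0)).Local v))
    (hr : Module.finrank ℂ r.V = 1) (hu : (IrrClass.mk r).IsUnitarizable) (ρ' : 𝔩.PktH) (hρ' : IrrClass.mk r ∈ 𝔩.memH ρ') :
    ρ' = 𝔩.packetHOfOneDimU h r hr hu :=
  (h r hr hu).choose_spec.2 ρ' hρ'

/-- **COMPATIBILITY with ★ FILE 1c**: under the strong law (ℓ8), the U-pinned packet (via `toU`) IS ★ `packetHOfOneDim` — both are THE packet containing `⟦r⟧`.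
[cite: Rogawski1990, §12.1] -/
theorem packetHOfOneDimU_toU_eq (𝔩 : LocalPacketKit L H' v) (h : 𝔩.OneDimHLaw)
    (r : SmoothIrrep ((UnitaryGroup.cmDatum L 2 (Matrix.of fun i j : Fin 2 => if i.val + j.val + 1 = 2 then (1 : L) else 0)).Local v ×
      (UnitaryGroup.cmDatum L 1 (Matrix.of fun i j : Fin 1 => if i.val + j.val + 1 = 1 then (1 : L) else 0)).Local v))
    (hr : Module.finrank ℂ r.V = 1) (hu : (IrrClass.mk r).IsUnitarizable) :
    𝔩.packetHOfOneDimU h.toU r hr hu = 𝔩.packetHOfOneDim h r hr :=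
  𝔩.eq_packetHOfOneDim_of_mem h r hr _ (by rw [memH_packetHOfOneDimU]; exact Finset.mem_singleton_self _)

/-! ## §3 Characters of `H_v` with UNITARIZABLE class: the packet `{⟦χ⟧}` [§13.1 p. 199 «`ξ ∈ Π(H)` one-dimensional»] -/

section Char

variable (𝔩 : LocalPacketKit L H' v)
  (χ : (UnitaryGroup.cmDatum L 2 (Matrix.of fun i j : Fin 2 => if i.val + j.val + 1 = 2 then (1 : L) else 0)).Local v ×
    (UnitaryGroup.cmDatum L 1 (Matrix.of fun i j : Fin 1 => if i.val + j.val + 1 = 1 then (1 : L) else 0)).Local v →* ℂˣ)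
  (hχ : IsOpen ((χ.ker : Subgroup ((UnitaryGroup.cmDatum L 2 (Matrix.of fun i j : Fin 2 => if i.val + j.val + 1 = 2 then (1 : L) else 0)).Local v ×
    (UnitaryGroup.cmDatum L 1 (Matrix.of fun i j : Fin 1 => if i.val + j.val + 1 = 1 then (1 : L) else 0)).Local v)) : Set ((UnitaryGroup.cmDatum L 2 (Matrix.of fun i j : Fin 2 => if i.val + j.val + 1 = 2 then (1 : L) else 0)).Local v ×
    (UnitaryGroup.cmDatum L 1 (Matrix.of fun i j : Fin 1 => if i.val + j.val + 1 = 1 then (1 : L) else 0)).Local v)))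

/-- **THE packet `{⟦χ⟧}` of a character `χ : H_v →* ℂˣ` (open kernel) with UNITARIZABLE class** under (ℓ8ᵁ) — what `rhoXiU ξ` reads at `χ := ξ.xiLocalChar v`, where
`hu` is ★ (U-2ξ).  U-twin of ★ `packetHOfChar`. [cite: Rogawski1990, §13.1 p. 199; §12.1] -/
def packetHOfCharU (h : 𝔩.OneDimHLawU) (hu : (IrrClass.mk (SmoothIrrep.ofChar χ hχ)).IsUnitarizable) : 𝔩.PktH :=
  𝔩.packetHOfOneDimU h (SmoothIrrep.ofChar χ hχ) (finrank_ofChar_V χ hχ) hu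

/-- Its member set is `{⟦χ⟧}`. [cite: Rogawski1990, §12.1; §13.1 p. 199] -/
theorem memH_packetHOfCharU (h : 𝔩.OneDimHLawU) (hu : (IrrClass.mk (SmoothIrrep.ofChar χ hχ)).IsUnitarizable) :
    𝔩.memH (𝔩.packetHOfCharU χ hχ h hu) = {IrrClass.mk (SmoothIrrep.ofChar χ hχ)} :=
  𝔩.memH_packetHOfOneDimU h _ _ hu

/-- It is the only packet containing `⟦χ⟧`. [cite: Rogawski1990, §12.1] -/
theorem eq_packetHOfCharU_of_mem (h : 𝔩.OneDimHLawU) (hu : (IrrClass.mk (SmoothIrrep.ofChar χ hχ)).IsUnitarizable)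
    (ρ' : 𝔩.PktH) (hρ' : IrrClass.mk (SmoothIrrep.ofChar χ hχ) ∈ 𝔩.memH ρ') : ρ' = 𝔩.packetHOfCharU χ hχ h hu :=
  𝔩.eq_packetHOfOneDimU_of_mem h _ _ hu ρ' hρ'

/-- The `H`-side trace of the packet `{⟦χ⟧}` is the single trace `tr ℂ_χ(f^H)` (★ `trPktH` over a singleton). [cite: Rogawski1990, §13.1 Prop. 13.1.4 p. 199] -/
theorem trPktH_packetHOfCharU (h : 𝔩.OneDimHLawU) (hu : (IrrClass.mk (SmoothIrrep.ofChar χ hχ)).IsUnitarizable)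
    [MeasurableSpace ((UnitaryGroup.cmDatum L 2 (Matrix.of fun i j : Fin 2 => if i.val + j.val + 1 = 2 then (1 : L) else 0)).Local v ×
      (UnitaryGroup.cmDatum L 1 (Matrix.of fun i j : Fin 1 => if i.val + j.val + 1 = 1 then (1 : L) else 0)).Local v)]
    (νH : Measure ((UnitaryGroup.cmDatum L 2 (Matrix.of fun i j : Fin 2 => if i.val + j.val + 1 = 2 then (1 : L) else 0)).Local v ×
      (UnitaryGroup.cmDatum L 1 (Matrix.of fun i j : Fin 1 => if i.val + j.val + 1 = 1 then (1 : L) else 0)).Local v))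
    (fH : (UnitaryGroup.cmDatum L 2 (Matrix.of fun i j : Fin 2 => if i.val + j.val + 1 = 2 then (1 : L) else 0)).Local v ×
      (UnitaryGroup.cmDatum L 1 (Matrix.of fun i j : Fin 1 => if i.val + j.val + 1 = 1 then (1 : L) else 0)).Local v → ℂ) :
    𝔩.trPktH νH (𝔩.packetHOfCharU χ hχ h hu) fH = (IrrClass.mk (SmoothIrrep.ofChar χ hχ)).smoothTrace νH fH := by
  unfold trPktH
  rw [memH_packetHOfCharU, Finset.sum_singleton]

/-- **COMPATIBILITY with ★ FILE 1c**: under (ℓ8), `packetHOfCharU … h.toU hu = packetHOfChar h …`. [cite: Rogawski1990, §12.1] -/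
theorem packetHOfCharU_toU_eq (h : 𝔩.OneDimHLaw) (hu : (IrrClass.mk (SmoothIrrep.ofChar χ hχ)).IsUnitarizable) :
    𝔩.packetHOfCharU χ hχ h.toU hu = 𝔩.packetHOfChar h χ hχ :=
  𝔩.packetHOfOneDimU_toU_eq h _ _ hu

/-- **`hu` FROM UNITARITY OF `χ`** (★ (U-2) `R90.S5.isUnitarizable_mk_ofChar_of_norm_eq_one`): the packet `{⟦χ⟧}` of a UNITARY character with open kernel under (ℓ8ᵁ).
[cite: Rogawski1990, §12.1 p. 171; §13.1 p. 199] [cite: BushnellHenniart2006, §11.1] -/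
def packetHOfCharU_of_norm_eq_one (h : 𝔩.OneDimHLawU) (hχu : ∀ g, ‖((χ g : ℂˣ) : ℂ)‖ = 1) : 𝔩.PktH :=
  𝔩.packetHOfCharU χ hχ h (R90.S5.isUnitarizable_mk_ofChar_of_norm_eq_one χ hχ hχu)

/-- Its member set is `{⟦χ⟧}`. [cite: Rogawski1990, §12.1] -/
theorem memH_packetHOfCharU_of_norm_eq_one (h : 𝔩.OneDimHLawU) (hχu : ∀ g, ‖((χ g : ℂˣ) : ℂ)‖ = 1) :
    𝔩.memH (𝔩.packetHOfCharU_of_norm_eq_one χ hχ h hχu) = {IrrClass.mk (SmoothIrrep.ofChar χ hχ)} :=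
  𝔩.memH_packetHOfCharU χ hχ h _

end Char

end LocalPacketKit

end Summit.HodgeConjecture.HodgeConjecture.Cruxes.H413.F0P3LocalPacketKit

/-! ## §4 Global twins: `charPacketU` and `rhoXiU` (the (e3) tuple `ρXi ξ = ξ` over (ℓ8ᵁ), `hu` discharged by ★ (U-2ξ)) -/

namespace Summit.HodgeConjecture.HodgeConjecture.Cruxes.H413.F0P3GlobalPacket.GlobalPacketH

open Literature.NumberTheory Literature.NumberTheory.Automorphic Literature.NumberTheory.Automorphic.UnitaryGroup
open Literature.NumberTheory.Rogawski1990 Literature.NumberTheory.GaloisRepresentations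
open Summit.HodgeConjecture.HodgeConjecture.Cruxes.H413.F0P3LocalPacketKit

variable {L : Type} [Field L] [NumberField L] [IsCMField L] {H' : Matrix (Fin 3) (Fin 3) L}
  {𝔩 : ∀ v : HeightOneSpectrum (𝓞 ↥(maximalRealSubfield L)), LocalPacketKit L H' v}

section CharFamily

variable
  (h8U : ∀ v : HeightOneSpectrum (𝓞 ↥(maximalRealSubfield L)), (𝔩 v).OneDimHLawU)
  (χ : ∀ v : HeightOneSpectrum (𝓞 ↥(maximalRealSubfield L)),
    (UnitaryGroup.cmDatum L 2 (Matrix.of fun i j : Fin 2 => if i.val + j.val + 1 = 2 then (1 : L) else 0)).Local v ×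
      (UnitaryGroup.cmDatum L 1 (Matrix.of fun i j : Fin 1 => if i.val + j.val + 1 = 1 then (1 : L) else 0)).Local v →* ℂˣ)
  (hχ : ∀ v : HeightOneSpectrum (𝓞 ↥(maximalRealSubfield L)),
    IsOpen (((χ v).ker : Subgroup ((UnitaryGroup.cmDatum L 2 (Matrix.of fun i j : Fin 2 => if i.val + j.val + 1 = 2 then (1 : L) else 0)).Local v ×
      (UnitaryGroup.cmDatum L 1 (Matrix.of fun i j : Fin 1 => if i.val + j.val + 1 = 1 then (1 : L) else 0)).Local v)) :
      Set ((UnitaryGroup.cmDatum L 2 (Matrix.of fun i j : Fin 2 => if i.val + j.val + 1 = 2 then (1 : L) else 0)).Local v ×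
        (UnitaryGroup.cmDatum L 1 (Matrix.of fun i j : Fin 1 => if i.val + j.val + 1 = 1 then (1 : L) else 0)).Local v)))
  (hu : ∀ v : HeightOneSpectrum (𝓞 ↥(maximalRealSubfield L)), (IrrClass.mk (SmoothIrrep.ofChar (χ v) (hχ v))).IsUnitarizable)

/-- **THE singleton packet family `{⟦χ_v⟧}_v` of a character family with UNITARIZABLE classes** under (ℓ8ᵁ) at every place (§3 `packetHOfCharU`).  U-twin of ★ FILE 3c
`charPacket`. [cite: Rogawski1990, §13.1 p. 199; §12.1] -/
def charPacketU : GlobalPacketH 𝔩 :=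
  ⟨fun v => (𝔩 v).packetHOfCharU (χ v) (hχ v) (h8U v) (hu v)⟩

/-- `charPacketU` IS the character's packet family (★ `IsCharPacket`). [cite: Rogawski1990, §12.1] -/
theorem isCharPacket_charPacketU : (charPacketU h8U χ hχ hu).IsCharPacket χ hχ :=
  fun v => (𝔩 v).memH_packetHOfCharU (χ v) (hχ v) (h8U v) (hu v)

/-- **UNIQUENESS**: any packet family with member sets `{⟦χ_v⟧}` is `charPacketU` (ℓ8ᵁ). [cite: Rogawski1990, §12.1] -/
theorem IsCharPacket.eq_charPacketU {ρ : GlobalPacketH 𝔩} (hρ : ρ.IsCharPacket χ hχ) : ρ = charPacketU h8U χ hχ hu := by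
  cases ρ with
  | mk loc =>
    simp only [charPacketU, GlobalPacketH.mk.injEq]
    funext v
    exact (𝔩 v).eq_packetHOfCharU_of_mem (χ v) (hχ v) (h8U v) (hu v) (loc v) (by rw [hρ v]; exact Finset.mem_singleton_self _)

/-- The `v`-component of `charPacketU` (definitional). [cite: Rogawski1990, §12.1] -/
theorem charPacketU_loc (v : HeightOneSpectrum (𝓞 ↥(maximalRealSubfield L))) :
    (charPacketU h8U χ hχ hu).loc v = (𝔩 v).packetHOfCharU (χ v) (hχ v) (h8U v) (hu v) :=
  rfl

end CharFamily

/-- **COMPATIBILITY with ★ FILE 3c**: under (ℓ8), `charPacketU (toU) … hu = charPacket h8 …` (both are THE family with member sets `{⟦χ_v⟧}`). [cite: Rogawski1990, §12.1] -/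
theorem charPacketU_toU_eq_charPacket
    (h8 : ∀ v : HeightOneSpectrum (𝓞 ↥(maximalRealSubfield L)), (𝔩 v).OneDimHLaw)
    (χ : ∀ v : HeightOneSpectrum (𝓞 ↥(maximalRealSubfield L)),
      (UnitaryGroup.cmDatum L 2 (Matrix.of fun i j : Fin 2 => if i.val + j.val + 1 = 2 then (1 : L) else 0)).Local v ×
        (UnitaryGroup.cmDatum L 1 (Matrix.of fun i j : Fin 1 => if i.val + j.val + 1 = 1 then (1 : L) else 0)).Local v →* ℂˣ)
    (hχ : ∀ v : HeightOneSpectrum (𝓞 ↥(maximalRealSubfield L)),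
      IsOpen (((χ v).ker : Subgroup ((UnitaryGroup.cmDatum L 2 (Matrix.of fun i j : Fin 2 => if i.val + j.val + 1 = 2 then (1 : L) else 0)).Local v ×
        (UnitaryGroup.cmDatum L 1 (Matrix.of fun i j : Fin 1 => if i.val + j.val + 1 = 1 then (1 : L) else 0)).Local v)) :
        Set ((UnitaryGroup.cmDatum L 2 (Matrix.of fun i j : Fin 2 => if i.val + j.val + 1 = 2 then (1 : L) else 0)).Local v ×
          (UnitaryGroup.cmDatum L 1 (Matrix.of fun i j : Fin 1 => if i.val + j.val + 1 = 1 then (1 : L) else 0)).Local v)))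
    (hu : ∀ v : HeightOneSpectrum (𝓞 ↥(maximalRealSubfield L)), (IrrClass.mk (SmoothIrrep.ofChar (χ v) (hχ v))).IsUnitarizable) :
    charPacketU (fun v => (h8 v).toU) χ hχ hu = charPacket h8 χ hχ :=
  (isCharPacket_charPacketU (fun v => (h8 v).toU) χ hχ hu).eq_charPacket h8 χ hχ

/-! ### `rhoXiU` — the tuple's `ρXi ξ = ξ` over (ℓ8ᵁ), `hu` discharged by ★ (U-2ξ) -/

/-- **(e3ᵁ) `rhoXiU h8U ξ` — THE GLOBAL `H`-PACKET `{⟦ξ_v⟧}_v` OF A ONE-DIMENSIONAL AUTOMORPHIC `ξ`, OVER THE SATISFIABLE LAW (ℓ8ᵁ)**: `charPacketU` at `χ v := ξ.xiLocalChar v`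
(★ `xiLocalChar`), open kernel ★ `isOpen_ker_xiLocalChar`, and the unitarizability `hu` DISCHARGED by ★ (U-2ξ) `R90.S5.isUnitarizable_mk_ofChar_xiLocalChar` (`‖ξ_v‖ = 1` from ★
`OneDimAutRepH.unit_η`∕`unit_ψ`).  Hypothesis-free but for (ℓ8ᵁ).  U-twin of ★ `rhoXi`. [cite: Rogawski1990, §13.1 p. 199; §12.1 p. 171] -/
def rhoXiU (h8U : ∀ v : HeightOneSpectrum (𝓞 ↥(maximalRealSubfield L)), (𝔩 v).OneDimHLawU) (ξ : OneDimAutRepH L) : GlobalPacketH 𝔩 :=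
  charPacketU h8U (fun v => ξ.xiLocalChar v) (fun v => F0P3XiLocalCharOpenKernel.isOpen_ker_xiLocalChar L ξ v)
    (fun v => R90.S5.isUnitarizable_mk_ofChar_xiLocalChar L ξ v)

/-- `rhoXiU h8U ξ` IS `ξ`'s packet family. [cite: Rogawski1990, §12.1 p. 171] -/
theorem rhoXiU_isCharPacket (h8U : ∀ v : HeightOneSpectrum (𝓞 ↥(maximalRealSubfield L)), (𝔩 v).OneDimHLawU) (ξ : OneDimAutRepH L) :
    (rhoXiU h8U ξ).IsCharPacket (fun v => ξ.xiLocalChar v) (fun v => F0P3XiLocalCharOpenKernel.isOpen_ker_xiLocalChar L ξ v) :=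
  isCharPacket_charPacketU h8U _ _ _

/-- **Uniqueness**: any `H`-packet family with member sets `{⟦ξ_v⟧}` is `rhoXiU h8U ξ`. [cite: Rogawski1990, §12.1 p. 171] -/
theorem eq_rhoXiU_of_isCharPacket (h8U : ∀ v : HeightOneSpectrum (𝓞 ↥(maximalRealSubfield L)), (𝔩 v).OneDimHLawU) (ξ : OneDimAutRepH L)
    {ρ : GlobalPacketH 𝔩} (hρ : ρ.IsCharPacket (fun v => ξ.xiLocalChar v) (fun v => F0P3XiLocalCharOpenKernel.isOpen_ker_xiLocalChar L ξ v)) :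
    ρ = rhoXiU h8U ξ :=
  hρ.eq_charPacketU h8U _ _ _

/-- `(rhoXiU h8U ξ).loc v` is §3's `packetHOfCharU` of `ξ_v` at `hu :=` ★ (U-2ξ) (definitional). [cite: Rogawski1990, §12.1 p. 171] -/
theorem rhoXiU_loc (h8U : ∀ v : HeightOneSpectrum (𝓞 ↥(maximalRealSubfield L)), (𝔩 v).OneDimHLawU) (ξ : OneDimAutRepH L)
    (v : HeightOneSpectrum (𝓞 ↥(maximalRealSubfield L))) :
    (rhoXiU h8U ξ).loc v = (𝔩 v).packetHOfCharU (ξ.xiLocalChar v) (F0P3XiLocalCharOpenKernel.isOpen_ker_xiLocalChar L ξ v) (h8U v)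
      (R90.S5.isUnitarizable_mk_ofChar_xiLocalChar L ξ v) :=
  rfl

/-- The member set of `(rhoXiU h8U ξ)_v` is `{⟦ξ_v⟧}`. [cite: Rogawski1990, §13.1 p. 199; §12.1 p. 171] -/
theorem memH_rhoXiU_loc (h8U : ∀ v : HeightOneSpectrum (𝓞 ↥(maximalRealSubfield L)), (𝔩 v).OneDimHLawU) (ξ : OneDimAutRepH L)
    (v : HeightOneSpectrum (𝓞 ↥(maximalRealSubfield L))) :
    (𝔩 v).memH ((rhoXiU h8U ξ).loc v) = {IrrClass.mk (SmoothIrrep.ofChar (ξ.xiLocalChar v) (F0P3XiLocalCharOpenKernel.isOpen_ker_xiLocalChar L ξ v))} :=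
  rhoXiU_isCharPacket h8U ξ v

/-- **COMPATIBILITY with ★ `rhoXi`**: under (ℓ8), `rhoXiU (toU) ξ = rhoXi h8 ξ`. [cite: Rogawski1990, §12.1 p. 171] -/
theorem rhoXiU_toU_eq_rhoXi (h8 : ∀ v : HeightOneSpectrum (𝓞 ↥(maximalRealSubfield L)), (𝔩 v).OneDimHLaw) (ξ : OneDimAutRepH L) :
    rhoXiU (fun v => (h8 v).toU) ξ = rhoXi h8 ξ :=
  charPacketU_toU_eq_charPacket h8 _ _ _

end Summit.HodgeConjecture.HodgeConjecture.Cruxes.H413.F0P3GlobalPacket.GlobalPacketH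

end
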